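import Summits.Ventures.PercRepro.Night2NearFatTen
import Summits.Ventures.PercRepro.Night2NearFatTop

/-!
# night-2: THE BASIS PAIRS AT THE TOP FOUR LEVELS — `N = 8, 9` WITH NO THREE-PLANAR HYPOTHESIS (gen 40)

At `|W| = 8` the non-suspect family of Night2NearFatFair lives at the levels `≥ 5 = |W| − 3`, at `|W| = 9` the family of the
levels `≥ 6 = |W| − 3` still has income `≥ 1` (the cell `(9, 6, 0, 0, 6, 6) = 457/455`): there every load is a distance-1 load
(Night2NearFatTop), so the shape lemma needs no three-planar hypothesis — **`basis_pair_fair_top_eight`**,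
**`basis_pair_fair_top_nine`**.  Paper: proofs/NIGHT-2-g40.md §8.
-/

namespace PercRepro.Shadow

open PercRepro.ThmH PercRepro.PerFlat

variable {α : Type*} [DecidableEq α] {M : Matroid α} [M.Finite] {G : Finset α}

/-- **`N = 8` with no three-planar hypothesis**: every basis line with `≤ 3` points of `W` and every line through a basis
point with `≤ 6` ⇒ the basis pair is fair (the family lives at the top four levels, where every load is a distance-1 load). -/
theorem basis_pair_fair_top_eight (hG : G ∈ flatsQ M (5 + 1)) (hd : (gr M \ G).card = 2)
    (hk : kColoops M G = 1) (hs : ∀ e ∈ gr M, ∀ f ∈ gr M, e ≠ f → rkN M {e, f} = 2)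
    (hl : ∀ e ∈ gr M, M.Indep {e}) (hnf : fatClosures M 5 G 2 = ∅)
    {B : Finset α} (hB : B ∈ thinMembers M 5 G) (hnP : ¬ bigP M G B) {z : α} (hz : z ∈ G \ clF M B)
    (hl0 : loss M 5 G B z ≠ 0) (hW : (G \ insert z B).card = 8)
    (h2 : ∀ a ∈ insert z B \ coloops M G, ∀ b ∈ insert z B \ coloops M G, a ≠ b →
      ((G \ insert z B) ∩ clF M {a, b}).card ≤ 3)
    (h1 : ∀ a ∈ insert z B \ coloops M G, ∀ y ∈ G \ insert z B, ((G \ insert z B) ∩ clF M {a, y}).card ≤ 6) :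
    loss M 5 G B z ≤ rhoL M 5 G B z * lossIncomeH M 5 G (bigP M G) (dshGT2 M 5 G) B z := by
  obtain ⟨ℓ₁, ℓ₂, C₁, C₂, hℓ₁, hℓ₂, hB2, hB1, ho₁, ho₂, -, hc₁, hc₂, hcc, -⟩ :=
    ntp_structure hG hd hk hs hl hB hnP hz (s := 5) (by norm_num) (by omega) (by omega)
  have hd₁ : ℓ₁.card = 0 := by
    rcases ho₁ with rfl | ⟨h4, a, ha, b, hb, hab, rfl⟩
    · exact Finset.card_empty
    · have := h2 a ha b hb hab; omega
  have hd₂ : ℓ₂.card = 0 := by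
    rcases ho₂ with rfl | ⟨h4, a, ha, b, hb, hab, rfl⟩
    · exact Finset.card_empty
    · have := h2 a ha b hb hab; omega
  have he₁ : C₁.card = 0 ∨ (5 ≤ C₁.card ∧ C₁.card ≤ 6) := by
    rcases hc₁ with rfl | ⟨h5, a, ha, y, hy, rfl⟩
    · exact Or.inl Finset.card_empty
    · exact Or.inr ⟨h5, h1 a ha y hy⟩
  have he₂ : C₂.card = 0 ∨ (5 ≤ C₂.card ∧ C₂.card ≤ 6) := by
    rcases hc₂ with rfl | ⟨h5, a, ha, y, hy, rfl⟩
    · exact Or.inl Finset.card_empty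
    · exact Or.inr ⟨h5, h1 a ha y hy⟩
  have hC₁W : C₁ ⊆ G \ insert z B := by
    rcases hc₁ with rfl | ⟨-, a, -, y, -, rfl⟩
    · exact Finset.empty_subset _
    · exact Finset.inter_subset_left
  have hC₂W : C₂ ⊆ G \ insert z B := by
    rcases hc₂ with rfl | ⟨-, a, -, y, -, rfl⟩
    · exact Finset.empty_subset _
    · exact Finset.inter_subset_left
  -- two long classes cannot coexist in eight points
  have hone : ∃ C : Finset α, C.card ≤ 6 ∧
      ∀ a ∈ insert z B \ coloops M G, ∀ y ∈ G \ insert z B,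
        (G \ insert z B) ∩ clF M {a, y} ⊆ C ∨ ((G \ insert z B) ∩ clF M {a, y}).card + 1 ≤ 5 := by
    rcases hcc with heq | hint
    · refine ⟨C₁, by rcases he₁ with h | h <;> omega, ?_⟩
      intro a ha y hy
      rcases hB1 a ha y hy with h | h | h
      · exact Or.inl h
      · exact Or.inl (heq ▸ h)
      · exact Or.inr h
    · have hone' : C₁.card = 0 ∨ C₂.card = 0 := by
        by_contra hno
        push Not at hno
        have hA := Finset.card_union_add_card_inter C₁ C₂
        have hU := Finset.card_le_card (Finset.union_subset hC₁W hC₂W)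
        rcases he₁ with h | h
        · exact hno.1 h
        rcases he₂ with h' | h'
        · exact hno.2 h'
        omega
      rcases hone' with h0 | h0
      · refine ⟨C₂, by rcases he₂ with h | h <;> omega, ?_⟩
        intro a ha y hy
        rcases hB1 a ha y hy with h | h | h
        · right
          rw [Finset.card_eq_zero] at h0
          rw [h0, Finset.subset_empty] at h
          rw [h, Finset.card_empty]
          norm_num
        · exact Or.inl h
        · exact Or.inr h
      · refine ⟨C₁, by rcases he₁ with h | h <;> omega, ?_⟩
        intro a ha y hy
        rcases hB1 a ha y hy with h | h | h
        · exact Or.inl h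
        · right
          rw [Finset.card_eq_zero] at h0
          rw [h0, Finset.subset_empty] at h
          rw [h, Finset.card_empty]
          norm_num
        · exact Or.inr h
  obtain ⟨C, hC6, hB1'⟩ := hone
  apply basis_pair_fair_of_ntp hG hd hk hs hl hnf hB hnP hz hl0 (by norm_num : 1 ≤ 5) _ hℓ₁ hℓ₂ hB2
    (C₁ := C) (C₂ := ∅) (fun a ha y hy => by
      rcases hB1' a ha y hy with h | h
      · exact Or.inl h
      · exact Or.inr (Or.inr h))
  · rw [hW, hd₁, hd₂, Finset.card_empty]
    exact le_trans one_le_ntpIncome_eight_zero_six (ntpIncome_anti_e hC6 le_rfl)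
  · intro Y hYW hYs hnS
    apply dload_eq_zero_of_shape_of_top hG hd hk hs hl hnf hB hnP hz hYW (by omega)
    · intro a ha b hb hab
      by_contra hlt
      exact hnS (Or.inl ⟨a, ha, b, hb, hab, by omega⟩)
    · intro a ha y hy hsub
      exact hnS (Or.inr ⟨a, ha, y, hy, hsub⟩)


/-- **`N = 9` with no three-planar hypothesis**: every basis line with `≤ 4` points of `W` and every line through a basis
point with `≤ 6` ⇒ the basis pair is fair — the family of the top four levels (`s = 6`), where every load is a distance-1 load. -/
theorem basis_pair_fair_top_nine (hG : G ∈ flatsQ M (5 + 1)) (hd : (gr M \ G).card = 2)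
    (hk : kColoops M G = 1) (hs : ∀ e ∈ gr M, ∀ f ∈ gr M, e ≠ f → rkN M {e, f} = 2)
    (hl : ∀ e ∈ gr M, M.Indep {e}) (hnf : fatClosures M 5 G 2 = ∅)
    {B : Finset α} (hB : B ∈ thinMembers M 5 G) (hnP : ¬ bigP M G B) {z : α} (hz : z ∈ G \ clF M B)
    (hl0 : loss M 5 G B z ≠ 0) (hW : (G \ insert z B).card = 9)
    (h2 : ∀ a ∈ insert z B \ coloops M G, ∀ b ∈ insert z B \ coloops M G, a ≠ b →
      ((G \ insert z B) ∩ clF M {a, b}).card ≤ 4)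
    (h1 : ∀ a ∈ insert z B \ coloops M G, ∀ y ∈ G \ insert z B, ((G \ insert z B) ∩ clF M {a, y}).card ≤ 6) :
    loss M 5 G B z ≤ rhoL M 5 G B z * lossIncomeH M 5 G (bigP M G) (dshGT2 M 5 G) B z := by
  obtain ⟨ℓ₁, ℓ₂, C₁, C₂, hℓ₁, hℓ₂, hB2, hB1, ho₁, ho₂, -, hc₁, hc₂, hcc, -⟩ :=
    ntp_structure hG hd hk hs hl hB hnP hz (s := 6) (by norm_num) (by omega) (by omega)
  have hd₁ : ℓ₁.card = 0 := by
    rcases ho₁ with rfl | ⟨h4, a, ha, b, hb, hab, rfl⟩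
    · exact Finset.card_empty
    · have := h2 a ha b hb hab; omega
  have hd₂ : ℓ₂.card = 0 := by
    rcases ho₂ with rfl | ⟨h4, a, ha, b, hb, hab, rfl⟩
    · exact Finset.card_empty
    · have := h2 a ha b hb hab; omega
  have he₁ : C₁.card = 0 ∨ (6 ≤ C₁.card ∧ C₁.card ≤ 6) := by
    rcases hc₁ with rfl | ⟨h5, a, ha, y, hy, rfl⟩
    · exact Or.inl Finset.card_empty
    · exact Or.inr ⟨h5, h1 a ha y hy⟩
  have he₂ : C₂.card = 0 ∨ (6 ≤ C₂.card ∧ C₂.card ≤ 6) := by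
    rcases hc₂ with rfl | ⟨h5, a, ha, y, hy, rfl⟩
    · exact Or.inl Finset.card_empty
    · exact Or.inr ⟨h5, h1 a ha y hy⟩
  have hC₁W : C₁ ⊆ G \ insert z B := by
    rcases hc₁ with rfl | ⟨-, a, -, y, -, rfl⟩
    · exact Finset.empty_subset _
    · exact Finset.inter_subset_left
  have hC₂W : C₂ ⊆ G \ insert z B := by
    rcases hc₂ with rfl | ⟨-, a, -, y, -, rfl⟩
    · exact Finset.empty_subset _
    · exact Finset.inter_subset_left
  -- two long classes cannot coexist in nine points
  have hone : ∃ C : Finset α, C.card ≤ 6 ∧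
      ∀ a ∈ insert z B \ coloops M G, ∀ y ∈ G \ insert z B,
        (G \ insert z B) ∩ clF M {a, y} ⊆ C ∨ ((G \ insert z B) ∩ clF M {a, y}).card + 1 ≤ 6 := by
    rcases hcc with heq | hint
    · refine ⟨C₁, by rcases he₁ with h | h <;> omega, ?_⟩
      intro a ha y hy
      rcases hB1 a ha y hy with h | h | h
      · exact Or.inl h
      · exact Or.inl (heq ▸ h)
      · exact Or.inr h
    · have hone' : C₁.card = 0 ∨ C₂.card = 0 := by
        by_contra hno
        push Not at hno
        have hA := Finset.card_union_add_card_inter C₁ C₂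
        have hU := Finset.card_le_card (Finset.union_subset hC₁W hC₂W)
        rcases he₁ with h | h
        · exact hno.1 h
        rcases he₂ with h' | h'
        · exact hno.2 h'
        omega
      rcases hone' with h0 | h0
      · refine ⟨C₂, by rcases he₂ with h | h <;> omega, ?_⟩
        intro a ha y hy
        rcases hB1 a ha y hy with h | h | h
        · right
          rw [Finset.card_eq_zero] at h0
          rw [h0, Finset.subset_empty] at h
          rw [h, Finset.card_empty]
          norm_num
        · exact Or.inl h
        · exact Or.inr h
      · refine ⟨C₁, by rcases he₁ with h | h <;> omega, ?_⟩
        intro a ha y hy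
        rcases hB1 a ha y hy with h | h | h
        · exact Or.inl h
        · right
          rw [Finset.card_eq_zero] at h0
          rw [h0, Finset.subset_empty] at h
          rw [h, Finset.card_empty]
          norm_num
        · exact Or.inr h
  obtain ⟨C, hC6, hB1'⟩ := hone
  apply basis_pair_fair_of_ntp hG hd hk hs hl hnf hB hnP hz hl0 (by norm_num : 1 ≤ 6) _ hℓ₁ hℓ₂ hB2
    (C₁ := C) (C₂ := ∅) (fun a ha y hy => by
      rcases hB1' a ha y hy with h | h
      · exact Or.inl h
      · exact Or.inr (Or.inr h))
  · rw [hW, hd₁, hd₂, Finset.card_empty]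
    exact le_trans one_le_ntpIncome_nine_six_six_six (ntpIncome_anti_e hC6 (Nat.zero_le _))
  · intro Y hYW hYs hnS
    apply dload_eq_zero_of_shape_of_top hG hd hk hs hl hnf hB hnP hz hYW (by omega)
    · intro a ha b hb hab
      by_contra hlt
      exact hnS (Or.inl ⟨a, ha, b, hb, hab, by omega⟩)
    · intro a ha y hy hsub
      exact hnS (Or.inr ⟨a, ha, y, hy, hsub⟩)


end PercRepro.Shadow
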